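import Literature.Barriers.AtomisticToContinuum.DisorderedHarmonicChainApproxKernelsFactors
import Literature.Barriers.AtomisticToContinuum.DisorderedHarmonicChainSweep
import Mathlib.MeasureTheory.Integral.Pi
import Mathlib.MeasureTheory.Constructions.Pi
import HarnessLib

/-!
# Ajanki–Huveneers 2011, App. 7.3: the law of `S_{y,n}` — product measure, Fourier coefficients, good frozen points

Fifth support file of the provefact unit for `AjankiHuveneers2011_approxKernels` (Lemma 5.2 of
O. Ajanki, F. Huveneers, CMP **301** (2011) 841–883, arXiv:1003.1076). The operator
`S_{y,n} = T_{y-nw} ⋯ T_{y-w}` of (5.8) acts on a bounded Borel `u` as the expectation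
`S_{y,n}u(x) = 𝔼 u(x + Z_n)`, `Z_n = ∑_{j<n} (ϑ + Φ(y_j, B_j))`, where the `B_j` are independent with
laws `ω_j(b)db = (1 + wh(y_j)b)τ(b)db`, `y_j = y - (j+1)w` (`ahSy_eq_integral_pi`, Fubini over the
last coordinate of `Measure.pi`); and the Fourier coefficients of the law of `Z_n` are
`𝔼 e^{2πiξZ_n} = e^{2πiξnw} ∏_j λ(y_j, ξ)` (`integral_cexp_ahZ`) — the paper's diagonalisation
"`(T_{y_k}e_ξ)(x) = γ_k(ξw)e_ξ(x)`" and (Pn) "`Λ_n(ξ) = ∏_k λ_k(wξ)`", here on the measure side so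
that it applies to `u` that is merely bounded Borel.

Also proved here: the paper's "there exists an integer `m ≥ n/2` independent of `y`, and a subsequence
`{k_j}` such that `|α_{k_j}| ≳ 1`" in counted form — for `dist(y, ℤ) ≥ ε`, `n ≥ 8`, `w ≤ w₆(ε)`, at
least `n/2` and at least `8` of the frozen points satisfy `sin²(πy_j) ≥ α₀(ε)` (`card_good_frozen_ge`,
from `DisorderedHarmonicChainSweep.card_far_int_ge`). No named facts are introduced.
-/

noncomputable section

open MeasureTheory Real Complex Set

namespace Literature.Barriers.AtomisticToContinuum.HeatConduction

/-! ### `S_{y,n}u(x)` as an expectation over the product law of the frozen increments -/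

section Law

variable {τ : ℝ → ℝ} {bm bp : ℝ} {w : ℝ} {h : ℝ → ℝ} {H : ℝ}

/-- The law `ω(b) db` of one reduced mass under the weight of the frozen step `T_{y'}`.
[cite: AjankiHuveneers2011, §5 eq. (5.6)] -/
def ahMu (τ : ℝ → ℝ) (w : ℝ) (h : ℝ → ℝ) (y' : ℝ) : Measure ℝ :=
  volume.withDensity fun b => ENNReal.ofReal (ahWt τ w h y' b)

/-- The frozen points `y_j = y - (j+1)w`, `j < n`, of `S_{y,n} = T_{y-nw} ⋯ T_{y-w}`.
[cite: AjankiHuveneers2011, §5 eq. (5.8)] -/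
def ahPt (y w : ℝ) {n : ℕ} (j : Fin n) : ℝ := y - ((j : ℕ) + 1) * w

/-- The product law of the `n` independent reduced masses driving `S_{y,n}`.
[cite: AjankiHuveneers2011, §5 eq. (5.8); App. 7.3] -/
def ahPiN (τ : ℝ → ℝ) (w : ℝ) (h : ℝ → ℝ) (y : ℝ) (n : ℕ) : Measure (Fin n → ℝ) :=
  Measure.pi fun j : Fin n => ahMu τ w h (ahPt y w j)

/-- The increment `s_j(b) = ϑ + Φ(y_j, b)` of the step frozen at `y_j` (`g_b(x, y_j) - x`).
[cite: AjankiHuveneers2011, §5 eq. (5.7)] -/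
def ahInc (w y : ℝ) {n : ℕ} (j : Fin n) (b : ℝ) : ℝ := ahTheta w + ahPhi w (ahPt y w j) b

/-- The total displacement `Z_n(B) = ∑_j s_j(B_j)` after the `n` frozen steps.
[cite: AjankiHuveneers2011, App. 7.3 (eq. (qn fourier))] -/
def ahZ (w y : ℝ) (n : ℕ) (B : Fin n → ℝ) : ℝ := ∑ j, ahInc w y j (B j)

/-- The frozen law is a probability measure once `w ‖h‖_∞ b_* ≤ 1/2`. [folklore] -/
theorem isProbabilityMeasure_ahMu (hτ : ReducedLawHyp τ bm bp) (hw : 0 ≤ w) (hH : ∀ z, |h z| ≤ H)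
    (hsmall : w * H * max |bm| |bp| ≤ 1 / 2) (y' : ℝ) : IsProbabilityMeasure (ahMu τ w h y') := by
  constructor
  unfold ahMu
  rw [withDensity_apply _ MeasurableSet.univ, Measure.restrict_univ,
    ← ofReal_integral_eq_lintegral_ofReal (integrable_ahWt hτ w h y')
      (ae_of_all _ (ahWt_nonneg hτ hw hH hsmall y')), integral_ahWt hτ, ENNReal.ofReal_one]

/-- `∫ g dμ_{y'} = ∫ g(b) ω(b) db`. [folklore] -/
theorem integral_ahMu (hτ : ReducedLawHyp τ bm bp) (hw : 0 ≤ w) (hH : ∀ z, |h z| ≤ H)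
    (hsmall : w * H * max |bm| |bp| ≤ 1 / 2) (y' : ℝ) {E : Type*} [NormedAddCommGroup E]
    [NormedSpace ℝ E] (g : ℝ → E) : ∫ b, g b ∂(ahMu τ w h y') = ∫ b, ahWt τ w h y' b • g b := by
  unfold ahMu
  rw [integral_withDensity_eq_integral_toReal_smul (measurable_ahWt hτ w h y').ennreal_ofReal
    (ae_of_all _ fun _ => ENNReal.ofReal_lt_top)]
  refine integral_congr_ae (ae_of_all _ fun b => ?_)
  dsimp only
  rw [ENNReal.toReal_ofReal (ahWt_nonneg hτ hw hH hsmall y' b)]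

/-- `B ↦ Z_n(B)` is measurable. [folklore] -/
theorem measurable_ahZ (w y : ℝ) (n : ℕ) : Measurable (ahZ w y n) := by
  unfold ahZ ahInc
  refine Finset.measurable_sum _ fun j _ => ?_
  exact measurable_const.add ((measurable_ahPhi_right w _).comp (measurable_pi_apply j))

/-- Splitting off the last coordinate: `Z_{n+1}(B) = Z_n(B ∘ castSucc) + s_n(B_n)`. [folklore] -/
theorem ahZ_succ (w y : ℝ) (n : ℕ) (B : Fin (n + 1) → ℝ) :
    ahZ w y (n + 1) B = ahZ w y n (fun j => B (Fin.castSucc j)) + ahInc w y (Fin.last n) (B (Fin.last n)) := by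
  unfold ahZ
  rw [Fin.sum_univ_castSucc]
  rfl

/-- **`S_{y,n}u(x) = 𝔼 u(x + Z_n)`**: the `n` frozen steps act on bounded Borel `u` as the
expectation of `u` translated by the sum of `n` independent increments `s_j(B_j)`, `B_j ~ ω_j(b)db`
(Fubini over the last coordinate, `measurePreserving_piFinSuccAbove`).
[cite: AjankiHuveneers2011, App. 7.3 (eq. (qn fourier))] -/
theorem ahSy_eq_integral_pi (hτ : ReducedLawHyp τ bm bp) (hw : 0 ≤ w) (hH : ∀ z, |h z| ≤ H)
    (hsmall : w * H * max |bm| |bp| ≤ 1 / 2) {u : ℝ → ℝ} (hu : Measurable u) {M : ℝ}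
    (hM : ∀ z, |u z| ≤ M) (y : ℝ) :
    ∀ (n : ℕ) (x : ℝ), ahSy τ w h y n u x = ∫ B, u (x + ahZ w y n B) ∂(ahPiN τ w h y n)
  | 0, x => by
    haveI : ∀ j : Fin 0, IsProbabilityMeasure (ahMu τ w h (ahPt y w j)) := fun j =>
      isProbabilityMeasure_ahMu hτ hw hH hsmall _
    simp [ahZ, ahPiN]
  | n + 1, x => by
    haveI hP : ∀ y', IsProbabilityMeasure (ahMu τ w h y') := fun y' =>
      isProbabilityMeasure_ahMu hτ hw hH hsmall y'
    rw [ahSy_succ]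
    -- the family of the `n+1` laws splits as (last) × (first `n`)
    have e := measurePreserving_piFinSuccAbove (fun j : Fin (n + 1) => ahMu τ w h (ahPt y w j)) (Fin.last n)
    have hsymm : ∀ p : ℝ × (Fin n → ℝ),
        (MeasurableEquiv.piFinSuccAbove (fun _ : Fin (n + 1) => ℝ) (Fin.last n)).symm p =
          Fin.snoc p.2 p.1 := fun p => by
      rw [← Fin.insertNth_last']
      rfl
    have hfam : (fun j : Fin n => ahMu τ w h (ahPt y w ((Fin.last n).succAbove j))) =
        fun j : Fin n => ahMu τ w h (ahPt y w j) := by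
      funext j; simp [ahPt, Fin.succAbove_last]
    have hlast : ahPt y w (Fin.last n) = y - (n + 1) * w := by simp [ahPt]
    -- integrability of the integrand on the `(n+1)`-fold product
    have hmeas : Measurable fun B : Fin (n + 1) → ℝ => u (x + ahZ w y (n + 1) B) :=
      hu.comp (measurable_const.add (measurable_ahZ w y (n + 1)))
    haveI : IsProbabilityMeasure (ahPiN τ w h y (n + 1)) := by unfold ahPiN; infer_instance
    have hI : Integrable (fun B : Fin (n + 1) → ℝ => u (x + ahZ w y (n + 1) B)) (ahPiN τ w h y (n + 1)) :=
      .of_bound hmeas.aestronglyMeasurable M (ae_of_all _ fun B => by rw [Real.norm_eq_abs]; exact hM _)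
    have e' := e.symm _
    symm
    unfold ahPiN at hI ⊢
    rw [← e'.integral_comp']
    rw [integral_prod (fun p : ℝ × (Fin n → ℝ) =>
        u (x + ahZ w y (n + 1) ((MeasurableEquiv.piFinSuccAbove (fun _ : Fin (n + 1) => ℝ) (Fin.last n)).symm p)))
      ((e'.integrable_comp_emb (MeasurableEquiv.measurableEmbedding _)).mpr hI)]
    rw [hfam, hlast]
    simp only [hsymm]
    have hin : ∀ b : ℝ, ∫ B : Fin n → ℝ, u (x + ahZ w y (n + 1) (Fin.snoc B b))
        ∂(Measure.pi fun j : Fin n => ahMu τ w h (ahPt y w j)) =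
        ahSy τ w h y n u (x + ahInc w y (Fin.last n) b) := fun b => by
      rw [ahSy_eq_integral_pi hτ hw hH hsmall hu hM y n]
      unfold ahPiN
      refine integral_congr_ae (ae_of_all _ fun B => ?_)
      dsimp only
      rw [ahZ_succ]
      simp only [Fin.snoc_castSucc, Fin.snoc_last]
      ring_nf
    simp only [hin]
    rw [integral_ahMu hτ hw hH hsmall]
    unfold ahTy
    refine integral_congr_ae (ae_of_all _ fun b => ?_)
    dsimp only
    rw [smul_eq_mul, mul_comm]
    congr 1
    unfold ahG ahInc
    rw [hlast]
    ring_nf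

/-- **The Fourier coefficients of the law of `Z_n`**:
`𝔼 e^{2πiξZ_n} = ∏_j 𝔼 e^{2πiξ s_j(B_j)} = e^{2πiξnw} ∏_j λ(y_j, ξ)` (independence, and
`s_j = w + c_j`). [cite: AjankiHuveneers2011, App. 7.3 (eqs. (diagonalization Tk), (Pn))] -/
theorem integral_cexp_ahZ (hτ : ReducedLawHyp τ bm bp) (hw : 0 ≤ w) (hH : ∀ z, |h z| ≤ H)
    (hsmall : w * H * max |bm| |bp| ≤ 1 / 2) (y : ℝ) (n : ℕ) (ξ : ℤ) :
    ∫ B, cexp (2 * π * I * ξ * ahZ w y n B) ∂(ahPiN τ w h y n) =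
      cexp (2 * π * I * ξ * (n * w)) * ∏ j : Fin n, ahLam τ w h (ahPt y w j) ξ := by
  haveI hP : ∀ y', IsProbabilityMeasure (ahMu τ w h y') := fun y' =>
    isProbabilityMeasure_ahMu hτ hw hH hsmall y'
  have hprod : (fun B : Fin n → ℝ => cexp (2 * π * I * ξ * ahZ w y n B)) =
      fun B => ∏ j : Fin n, cexp (2 * π * I * ξ * ahInc w y j (B j)) := by
    funext B
    unfold ahZ
    rw [← Complex.exp_sum]
    congr 1
    push_cast
    rw [Finset.mul_sum]
  unfold ahPiN
  rw [hprod, integral_fintype_prod_eq_prod (fun (j : Fin n) (b : ℝ) => cexp (2 * π * I * ξ * ahInc w y j b))]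
  have hfac : ∀ j : Fin n, ∫ b, cexp (2 * π * I * ξ * ahInc w y j b) ∂(ahMu τ w h (ahPt y w j)) =
      cexp (2 * π * I * ξ * w) * ahLam τ w h (ahPt y w j) ξ := fun j => by
    rw [integral_ahMu hτ hw hH hsmall]
    unfold ahLam
    rw [← integral_const_mul]
    refine integral_congr_ae (ae_of_all _ fun b => ?_)
    dsimp only
    rw [Complex.real_smul, ← mul_assoc, ← Complex.exp_add]
    unfold ahInc ahC
    rw [mul_comm]
    congr 2
    push_cast
    ring
  simp only [hfac, Finset.prod_mul_distrib, Finset.prod_const, Finset.card_univ, Fintype.card_fin]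
  congr 1
  rw [← Complex.exp_nat_mul]
  congr 1
  ring

end Law


/-! ### Good frozen points: at least half of the `y_j` are away from `ℤ` -/

section Good

/-- All frozen points are away from `ℤ` while the sweep has not left `B(y, ε/2)`:
if `dist(y, ℤ) ≥ ε` and `(j+1)w ≤ ε/2` then `sin²(π(y - (j+1)w)) ≥ ε²`.
[cite: AjankiHuveneers2011, App. 7.3 ("`|α_{k_j}| ≳ 1`")] -/
theorem sin_sq_frozen_ge {ε y : ℝ} (hε : 0 ≤ ε) (hfar : ∀ k : ℤ, ε ≤ |y - k|) {t : ℝ} (ht0 : 0 ≤ t)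
    (ht : t ≤ ε / 2) : ε ^ 2 ≤ Real.sin (π * (y - t)) ^ 2 := by
  have h1 : ε / 2 ≤ |y - t - round (y - t)| := by
    have h2 := hfar (round (y - t))
    have h3 : |y - round (y - t)| ≤ |y - t - round (y - t)| + t := by
      calc |y - round (y - t)| = |(y - t - round (y - t)) + t| := by ring_nf
        _ ≤ |y - t - round (y - t)| + |t| := abs_add_le _ _
        _ = |y - t - round (y - t)| + t := by rw [abs_of_nonneg ht0]
    linarith
  have := sin_sq_ge_of_far_int (by linarith) h1
  nlinarith

/-- **At least half (and at least `8`) of the frozen points `y_j = y - (j+1)w`, `j < n`, satisfy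
`sin²(πy_j) ≥ α₀`**, for `dist(y, ℤ) ≥ ε`, `n ≥ 8` and `w ≤ w₆(ε)` (`α₀ = α₀(ε)`): the paper's
"there exists an integer `m ≥ n/2` independent of `y`, and a subsequence `{k_j : 1 ≤ j ≤ m}` such
that `|α_{k_j}| ≳ 1`" — either the sweep `j ↦ y_j` stays in `B(y, ε/2)` (then all points are good),
or `nw > ε/2` and the counted form of Cor. 3.4 (i) (`card_far_int_ge`) applies.
[cite: AjankiHuveneers2011, App. 7.3 (second observation in the proof of Lemma `lambda`)] -/
theorem card_good_frozen_ge {ε : ℝ} (hε : 0 < ε) :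
    ∃ w₆ : ℝ, 0 < w₆ ∧ ∃ α₀ : ℝ, 0 < α₀ ∧ α₀ ≤ 1 ∧ ∀ w ∈ Ioc 0 w₆, ∀ n : ℕ, 8 ≤ n → ∀ y : ℝ,
      (∀ k : ℤ, ε ≤ |y - k|) →
        (n : ℝ) / 2 ≤ (((Finset.range n).filter fun j : ℕ =>
          α₀ ≤ Real.sin (π * (y - ((j : ℝ) + 1) * w)) ^ 2).card : ℕ) ∧
        8 ≤ ((Finset.range n).filter fun j : ℕ =>
          α₀ ≤ Real.sin (π * (y - ((j : ℝ) + 1) * w)) ^ 2).card := by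
  obtain ⟨η, hη⟩ : ∃ η : ℝ, η = min (ε / 96) (1 / 16) := ⟨_, rfl⟩
  have hη0 : 0 < η := by rw [hη]; exact lt_min (by positivity) (by norm_num)
  have hηε : η ≤ ε / 96 := hη ▸ min_le_left _ _
  have hη16 : η ≤ 1 / 16 := hη ▸ min_le_right _ _
  refine ⟨min (1 / 8) (ε / 48), by positivity, 4 * η ^ 2, by positivity, by nlinarith, ?_⟩
  intro w hw n hn y hfar
  obtain ⟨hw0, hwle⟩ := hw
  have hw8 : w ≤ 1 / 8 := hwle.trans (min_le_left _ _)
  have hw48 : w ≤ ε / 48 := hwle.trans (min_le_right _ _)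
  set G := (Finset.range n).filter fun j : ℕ => 4 * η ^ 2 ≤ Real.sin (π * (y - ((j : ℝ) + 1) * w)) ^ 2
    with hG
  have hα₀ε : 4 * η ^ 2 ≤ ε ^ 2 := by nlinarith
  by_cases hsweep : (n : ℝ) * w ≤ ε / 2
  · -- all points are good
    have hall : G = Finset.range n := by
      rw [hG]
      refine Finset.filter_true_of_mem fun j hj => ?_
      rw [Finset.mem_range] at hj
      have hj' : ((j : ℝ) + 1) ≤ n := by exact_mod_cast hj
      have ht : ((j : ℝ) + 1) * w ≤ ε / 2 := le_trans (mul_le_mul_of_nonneg_right hj' hw0.le) hsweep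
      exact hα₀ε.trans (sin_sq_frozen_ge hε.le hfar (by positivity) ht)
    rw [hall, Finset.card_range]
    exact ⟨by linarith, hn⟩
  · push Not at hsweep
    have hn24 : (24 : ℝ) ≤ n := by
      by_contra hcon
      push Not at hcon
      have : (n : ℝ) * w < 24 * (ε / 48) := by nlinarith
      linarith
    -- the sweep `X_k = (k+1)w - y`
    have hcount := card_far_int_ge (X := fun k : ℕ => ((k : ℝ) + 1) * w - y) (d₁ := w) (d₂ := w) hw0 hη0
      (fun k => by push_cast; ring_nf; exact le_rfl) (fun k => by push_cast; ring_nf; exact le_rfl) 0 n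
      (by nlinarith) hw8 (by nlinarith) hn24
    rw [zero_add, ← Finset.range_eq_Ico] at hcount
    have hsub : ((Finset.range n).filter fun k : ℕ => η ≤ |((k : ℝ) + 1) * w - y - round (((k : ℝ) + 1) * w - y)|)
        ⊆ G := by
      intro k hk
      rw [Finset.mem_filter] at hk ⊢
      refine ⟨hk.1, ?_⟩
      have := sin_sq_ge_of_far_int hη0.le hk.2
      have hneg : Real.sin (π * (y - ((k : ℝ) + 1) * w)) ^ 2 = Real.sin (π * (((k : ℝ) + 1) * w - y)) ^ 2 := by
        rw [show π * (y - ((k : ℝ) + 1) * w) = -(π * (((k : ℝ) + 1) * w - y)) by ring, Real.sin_neg, neg_sq]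
      rw [hneg]; exact this
    have hcard := Finset.card_le_card hsub
    have hcardR : (n : ℝ) / 2 ≤ (G.card : ℕ) := hcount.trans (by exact_mod_cast hcard)
    refine ⟨hcardR, ?_⟩
    have : (8 : ℝ) ≤ (G.card : ℕ) := by linarith
    exact_mod_cast this

end Good

end Literature.Barriers.AtomisticToContinuum.HeatConduction
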